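import Summits.BirchSwinnertonDyer.BirchSwinnertonDyer.Theorems.CumulativeHeegnerLeopoldtCumulativeHeegnerInclusionAtThreeTadicPinOfControl
import Summits.BirchSwinnertonDyer.Rank1Residual.X11b.UnrSeriesIdealEqualityDescent
import HarnessLib

/-!
# Crux K1 `CumulativeHeegnerInclusionAtThree` (stmt-BirchSwinnertonDyer-24198), line `birth`: RIGIDITY AT
# ONE POINT — the divisibility `(L) ⊆ (g)` of K1 together with the equality `‖L(x₀)‖ = ‖g(x₀)‖ ≠ 0` at a
# SINGLE point of the open disc (e.g. the trivial character: `ord₃ L(𝟙) = ord₃ g(𝟙)`, the BSD₃ formula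
# over `K` read through Liu–Zhang–Zhang and the control crux K4) is the full equality `(L) = (g)` in `Λ^ur`

Width seat bsd-line-chl-k1-p1-w2 (`--supports stmt-BirchSwinnertonDyer-24198`), Λ^ur-adapter lane. The
kernel `LeopoldtKernelAtThree` runs «K1 (inclusion) + K2 (`μ = 0`, equal `λ`) ⟹ equality of ideals ⟹
exact index ⟹ BSD₃». This file records the classical converse rigidity in the receptacle `R₀⟦T⟧`
(one divisibility + the special-value formula at ONE specialisation ⟹ the main-conjecture equality —
the argument by which a one-sided Euler-system divisibility is upgraded once the leading-term formula
is known at a single character):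

* §1 `isUnit_of_norm_value_eq_one`: `q ∈ R₀⟦T⟧` with `‖q(x₀)‖ = 1` at some `‖x₀‖ < 1` is a UNIT
  (`‖q(x₀) − q(0)‖ ≤ ‖x₀‖ < 1`, tree `norm_value_sub_constantCoeff_le`; a non-unit has `‖q(0)‖ < 1`,
  tree `norm_constantCoeff_lt_one_of_not_isUnit`).
* §2 **`span_eq_span_of_mem_span_of_norm_value_eq`**: `L ∈ (g)`, `‖L(x₀)‖ = ‖g(x₀)‖`, `g(x₀) ≠ 0` at one
  point `x₀` of the open disc ⟹ `(L) = (g)`; at the trivial character: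
  `span_eq_span_of_mem_span_of_norm_constantCoeff_eq` (`‖L(0)‖ = ‖g(0)‖ ≠ 0`).
* §3 in the vocabulary of K1/K4: **`map_charIdeal_eq_span_of_le_of_norm_constantCoeff_eq`** — if
  `XAc.HasCharValuationAt W p κ 𝔭 S γ n` (K4's shape: `Ch_Λ X = (f)`, `ord_p f(0) = n`),
  `span{L} ≤ (Ch_Λ X).map toUnr` (K1's shape) and `‖L(0)‖ = p^{-n}` (the analytic side has the SAME
  order at the trivial character — on the cell: `ord₃ ℒ_𝔭(𝟙) = 2·ord₃ log y_K` by LZZ versus the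
  control exponent `n`, i.e. the BSD₃ formula over `K`), then `(Ch_Λ X).map toUnr = span{L}` — the
  anticyclotomic main conjecture in `Λ^ur` for that datum.

HONEST FRAMING: pure algebra on the receptacle plus reading the `HasCharValuationAt` shape; the BSD₃
formula is NOT proved here (it is the route's GOAL — this file is the converse bookkeeping, useful for
per-curve certificate arguments and for checking the kernel's equality step); closes nothing by itself.
No definition, no named fact, no `sorry`. BSD is not proved by any of this; no summit statement is
proved by this seat.

References: [Washington1997] §7.1; [SkinnerUrban2014] §3.6.3 (divisibility + specialisation ⟹ equality
pattern); [Castella2018] Thm. 2.3; route-BirchSwinnertonDyer-CumulativeHeegnerLeopoldt (kernel K1+K2 ⟹ BSD₃).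
-/

set_option autoImplicit false
-- `…BirchSwinnertonDyer.BirchSwinnertonDyer.Theorems…` is the problem's mandated namespace (D-0017).
set_option linter.dupNamespace false

noncomputable section

open scoped Classical

open PowerSeries NumberField IsDedekindDomain Field Literature.NumberTheory.EllipticCurves
  Summit.BirchSwinnertonDyer.Rank1Residual.X11b
  Summit.BirchSwinnertonDyer.Rank1Residual.X11b.Halves
  Summit.BirchSwinnertonDyer.Rank1Residual.X11b.AcSelmer
  Summit.BirchSwinnertonDyer.BirchSwinnertonDyer.Theorems.CongruentShaFreeCutUnrSeriesWeierstrass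
  Summit.BirchSwinnertonDyer.BirchSwinnertonDyer.Theorems.CumulativeHeegnerInclusionAtThreeTadicPinOfControl

namespace Summit.BirchSwinnertonDyer.BirchSwinnertonDyer.Theorems.CumulativeHeegnerInclusionAtThreeUnrSeriesEqualityFromOnePoint

universe u

variable {p : ℕ} [hp : Fact p.Prime]

/-! ### §1 An element of `R₀⟦T⟧` of absolute value `1` at one point of the open disc is a unit -/

/-- **`‖q(x₀)‖ = 1` at one point `‖x₀‖ < 1` ⟹ `q` is a unit of `R₀⟦T⟧`**: `‖q(x₀) − q(0)‖ ≤ ‖x₀‖ < 1`, so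
`‖q(0)‖ = 1`, i.e. `q(0) ∈ R₀^×`. [cite: Washington1997, §7.1] -/
theorem isUnit_of_norm_value_eq_one {q : UnrSeries p} {x₀ w : ℂ_[p]} (hx : ‖x₀‖ < 1)
    (hw : q.HasValueAt x₀ w) (hw1 : ‖w‖ = 1) : IsUnit q := by
  by_contra hq
  have h0 : ‖((constantCoeff q : unrIntegers p) : ℂ_[p])‖ < 1 := norm_constantCoeff_lt_one_of_not_isUnit hq
  have h1 : ‖w - ((constantCoeff q : unrIntegers p) : ℂ_[p])‖ < 1 :=
    (norm_value_sub_constantCoeff_le hx hw).trans_lt hx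
  have h2 : ‖w‖ < 1 := by
    have := IsUltrametricDist.norm_add_le_max (w - ((constantCoeff q : unrIntegers p) : ℂ_[p]))
      ((constantCoeff q : unrIntegers p) : ℂ_[p])
    rw [sub_add_cancel] at this
    exact this.trans_lt (max_lt h1 h0)
  exact (lt_irrefl (1 : ℝ)) (hw1 ▸ h2)

/-! ### §2 Divisibility + equality of absolute values at one point ⟹ equality of ideals -/

/-- **Rigidity at one point.** If `L ∈ (g)` in `R₀⟦T⟧` and at some point `x₀` of the open unit disc of
`ℂ_p` one has `g(x₀) ≠ 0` and `‖L(x₀)‖ = ‖g(x₀)‖`, then `(L) = (g)` (the quotient `q = L/g` has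
`‖q(x₀)‖ = 1`, hence is a unit). [cite: SkinnerUrban2014, §3.6.3] -/
theorem span_eq_span_of_mem_span_of_norm_value_eq {g L : UnrSeries p} (h : L ∈ Ideal.span {g})
    {x₀ u v : ℂ_[p]} (hx : ‖x₀‖ < 1) (hu : g.HasValueAt x₀ u) (hv : L.HasValueAt x₀ v) (hu0 : u ≠ 0)
    (heq : ‖v‖ = ‖u‖) : Ideal.span {L} = Ideal.span {g} := by
  obtain ⟨q, rfl⟩ := Ideal.mem_span_singleton'.mp h
  obtain ⟨w, hw⟩ := exists_hasValueAt q hx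
  have h1 : UnrSeries.HasValueAt (q * g) x₀ (w * u) := hasValueAt_mul hx hw hu
  have h2 : v = w * u := hv.unique h1
  have hw1 : ‖w‖ = 1 := by
    have h3 : ‖w‖ * ‖u‖ = 1 * ‖u‖ := by rw [← norm_mul, ← h2, heq, one_mul]
    exact mul_right_cancel₀ (norm_ne_zero_iff.mpr hu0) h3
  exact Ideal.span_singleton_mul_left_unit (isUnit_of_norm_value_eq_one hx hw hw1) g

/-- **Rigidity at the trivial character.** If `L ∈ (g)`, `g(0) ≠ 0` and `‖L(0)‖ = ‖g(0)‖` (equality of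
the orders at `T = 0`), then `(L) = (g)`. [cite: SkinnerUrban2014, §3.6.3] -/
theorem span_eq_span_of_mem_span_of_norm_constantCoeff_eq {g L : UnrSeries p} (h : L ∈ Ideal.span {g})
    (hg0 : constantCoeff g ≠ 0)
    (heq : ‖((constantCoeff L : unrIntegers p) : ℂ_[p])‖ = ‖((constantCoeff g : unrIntegers p) : ℂ_[p])‖) :
    Ideal.span {L} = Ideal.span {g} := by
  refine span_eq_span_of_mem_span_of_norm_value_eq h (x₀ := 0) (by rw [norm_zero]; exact one_pos)
    g.hasValueAt_zero L.hasValueAt_zero ?_ heq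
  intro h0
  exact hg0 (Subtype.ext (by rw [h0]; rfl))

/-- Ideal form: `span{L} ≤ span{g}`, `g(0) ≠ 0`, `‖L(0)‖ = ‖g(0)‖` ⟹ `span{L} = span{g}`.
[cite: SkinnerUrban2014, §3.6.3] -/
theorem span_eq_span_of_le_of_norm_constantCoeff_eq {g L : UnrSeries p}
    (h : Ideal.span {L} ≤ Ideal.span {g}) (hg0 : constantCoeff g ≠ 0)
    (heq : ‖((constantCoeff L : unrIntegers p) : ℂ_[p])‖ = ‖((constantCoeff g : unrIntegers p) : ℂ_[p])‖) :
    Ideal.span {L} = Ideal.span {g} :=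
  span_eq_span_of_mem_span_of_norm_constantCoeff_eq ((Ideal.span_singleton_le_iff_mem _).mp h) hg0 heq

/-! ### §3 In the vocabulary of K1 / K4: inclusion + the order at `𝟙` ⟹ the main-conjecture equality -/

section Control

variable {K : Type u} [Field K] [NumberField K] {W : WeierstrassCurve K} {κ : ZpExtension K p}
  {𝔭 : HeightOneSpectrum (𝓞 K)} {S : Set (HeightOneSpectrum (𝓞 K))} {γ : absoluteGaloisGroup K}
  [Fact (κ.IsTopGenerator γ)]

/-- The norm in `ℂ_p` of the constant term of `f.map toUnr`, for `f ∈ Λ` with `f(0) ≠ 0` of `p`-adic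
valuation `n`, is `p^{-n}`. [folklore] -/
theorem norm_constantCoeff_map_toUnr_eq {f : IwasawaAlgebra p} {n : ℕ} (hf0 : constantCoeff f ≠ 0)
    (hfn : (constantCoeff f).valuation = n) :
    ‖((constantCoeff ((PowerSeries.map (toUnr p)) f) : unrIntegers p) : ℂ_[p])‖ = ((p : ℝ)⁻¹) ^ n := by
  rw [constantCoeff_map_toUnr, coe_toUnr, norm_algebraMap', PadicInt.padic_norm_e_of_padicInt,
    PadicInt.norm_eq_zpow_neg_valuation hf0, hfn, inv_pow, ← zpow_natCast, ← zpow_neg]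

/-- **K1's inclusion + the order at the trivial character ⟹ the anticyclotomic main-conjecture equality
in `Λ^ur`.** If `XAc.HasCharValuationAt W p κ 𝔭 S γ n` (K4's shape: `Ch_Λ X_ac = (f)`, `ord_p f(0) = n`),
`span{L} ≤ (Ch_Λ X_ac).map toUnr` (K1's shape) and `‖L(0)‖ = p^{-n}` (the analytic side has order exactly
`n` at `𝟙` — on the Leopoldt cell this is the BSD₃ formula over `K`, via Liu–Zhang–Zhang's value
`ℒ_𝔭(𝟙) = unit · log² y_K` and the control identity for `n`), then `(Ch_Λ X_ac).map toUnr = span{L}`.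
[cite: SkinnerUrban2014, §3.6.3] [cite: Castella2018, Thm. 2.3] -/
theorem map_charIdeal_eq_span_of_le_of_norm_constantCoeff_eq {n : ℕ}
    (h : XAc.HasCharValuationAt W p κ 𝔭 S γ n) {L : UnrSeries p}
    (hle : Ideal.span {L} ≤ (XAc.charIdeal W p κ 𝔭 S γ).map (PowerSeries.map (toUnr p)))
    (hL0 : ‖((constantCoeff L : unrIntegers p) : ℂ_[p])‖ = ((p : ℝ)⁻¹) ^ n) :
    (XAc.charIdeal W p κ 𝔭 S γ).map (PowerSeries.map (toUnr p)) = Ideal.span {L} := by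
  obtain ⟨-, f, hf, hf0, hfn⟩ := h
  have hmap : (XAc.charIdeal W p κ 𝔭 S γ).map (PowerSeries.map (toUnr p)) =
      Ideal.span {(PowerSeries.map (toUnr p)) f} := by rw [hf, map_span_singleton_toUnr]
  rw [hmap] at hle ⊢
  exact (span_eq_span_of_le_of_norm_constantCoeff_eq hle (constantCoeff_map_toUnr_ne_zero hf0)
    (by rw [hL0, norm_constantCoeff_map_toUnr_eq hf0 hfn])).symm

end Control

end Summit.BirchSwinnertonDyer.BirchSwinnertonDyer.Theorems.CumulativeHeegnerInclusionAtThreeUnrSeriesEqualityFromOnePoint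

end
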